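import Summits.Schanuel.Schanuel.Theorems.RootDecomp1EEStableStructure

/-!
# RootDecomp1E — the STABILIZER FIELD `K_V` of a span (lens-2 g7, round 7 «MultiplicationType»; FOREST RULING R2)

Support for `EStableDefectOne` (stmt-Schanuel-31409) and `PlainDefectOne` (stmt-Schanuel-31410) of
`Summits/Schanuel/Schanuel/Theses/RootDecomp1E.lean`.  For `V = span_ℚ z` the set
`K_V = {q ∈ ℂ : q · V ⊆ V}` is an INTERMEDIATE FIELD of `ℂ/ℚ` (`stabilizer z`; inverse-closed because multiplication by
`q ≠ 0` is an injective endomorphism of the finite-dimensional `V`, hence onto).  For `V ≠ 0`: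

* `stabilizer_finiteDimensional`, `finrank_stabilizer_le` (`[K_V:ℚ] ≤ n`), `exists_primitive_multiplier`
  (`K_V = ℚ(β)` for one multiplier `β`), `finrank_stabilizer_dvd` (`[K_V:ℚ] ∣ n`);
* `eStable_iff_two_le_finrank` : E-STABLE `↔ 2 ≤ [K_V:ℚ]`;  `plain_iff_stabilizer_eq_bot` : PLAIN `↔ K_V = ⊥`;
* `eStable_canonical_structure` : the canonical cell of an E-stable span — a ℚ-basis `β^k · w_j` with `β` primitive,
  `d = [K_V:ℚ]`, `m = n/d` (cells indexed by the MAXIMAL multiplier field, so the union over `d ∣ n` is disjoint);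
* `symmetric_iff_stabilizer_ne_bot` / `asymmetric_iff_stabilizer_eq_bot` : lens-1's `SymmetryLayer` predicates are
  `K_V ≠ ⊥` / `K_V = ⊥` with NO hypothesis on `z` — `K_V` is the one classifier behind both lenses' round-7 cuts.

Imports the structure file `Theorems.RootDecomp1EEStableStructure` (tower law, `degree_dvd`, `eStable_structure`).
-/

set_option linter.dupNamespace false

namespace Summit.Schanuel.Schanuel.Theorems.RootDecomp1EStabilizerField

open IntermediateField Module
open Summit.Schanuel.Schanuel.Theorems.RootDecomp1EEStableStructure (mul_mem_span_of_gens degree_dvd eStable_structure)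


variable {n : ℕ}

/-- **The stabilizer field** `K_V = {q ∈ ℂ : q · V ⊆ V}` of `V = span_ℚ z` — an intermediate field of `ℂ/ℚ`
(closed under inverses because multiplication by `q ≠ 0` is an injective, hence surjective, endomorphism of the
finite-dimensional `V`).  This is the ONE classifier behind both lens-1's `symmetric/asymmetric` and lens-2's
`EStable/Plain` (FOREST RULING R2): `EStable n z ↔ 2 ≤ [K_V : ℚ]`, `Plain n z ↔ K_V = ℚ` (for `V ≠ 0`). -/
noncomputable def stabilizer (z : Fin n → ℂ) : IntermediateField ℚ ℂ where
  carrier := {q | ∀ v ∈ Submodule.span ℚ (Set.range z), q * v ∈ Submodule.span ℚ (Set.range z)}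
  mul_mem' := by
    intro a b ha hb v hv
    rw [mul_assoc]; exact ha _ (hb v hv)
  one_mem' := by intro v hv; simpa using hv
  add_mem' := by
    intro a b ha hb v hv
    rw [add_mul]; exact add_mem (ha v hv) (hb v hv)
  zero_mem' := by intro v hv; simp
  algebraMap_mem' := by
    intro r v hv
    rw [Algebra.algebraMap_eq_smul_one, smul_mul_assoc, one_mul]; exact Submodule.smul_mem _ r hv
  inv_mem' := by
    intro q hq
    by_cases hq0 : q = 0
    · subst hq0; intro v hv; simp
    · haveI : FiniteDimensional ℚ ↥(Submodule.span ℚ (Set.range z)) :=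
        FiniteDimensional.span_of_finite ℚ (Set.finite_range z)
      let f : ↥(Submodule.span ℚ (Set.range z)) →ₗ[ℚ] ↥(Submodule.span ℚ (Set.range z)) :=
        { toFun := fun v => ⟨q * v, hq v v.2⟩
          map_add' := fun v w => by ext; simp [mul_add]
          map_smul' := fun r v => by ext; simp }
      have hinj : Function.Injective f := by
        intro v w h
        have h' : q * (v : ℂ) = q * w := congrArg (fun u : ↥(Submodule.span ℚ (Set.range z)) => (u : ℂ)) h
        exact Subtype.ext (mul_left_cancel₀ hq0 h')
      intro v hv
      obtain ⟨w, hw⟩ := (LinearMap.injective_iff_surjective.mp hinj) ⟨v, hv⟩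
      have hw' : q * (w : ℂ) = v := congrArg (fun u : ↥(Submodule.span ℚ (Set.range z)) => (u : ℂ)) hw
      have : q⁻¹ * v = w := by rw [← hw', ← mul_assoc, inv_mul_cancel₀ hq0, one_mul]
      rw [this]; exact w.2

/-- Membership in the stabilizer field `K_V`: `q ∈ K_V` iff `q · V ⊆ V` for `V = span_ℚ z`. -/
theorem mem_stabilizer_iff (z : Fin n → ℂ) (q : ℂ) :
    q ∈ stabilizer z ↔
      ∀ v ∈ Submodule.span ℚ (Set.range z), q * v ∈ Submodule.span ℚ (Set.range z) := Iff.rfl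

/-- A number multiplying every generator `z i` into `span_ℚ z` lies in the stabilizer field. -/
theorem mem_stabilizer_of_gens (z : Fin n → ℂ) {β : ℂ} (hβ : ∀ i, β * z i ∈ Submodule.span ℚ (Set.range z)) :
    β ∈ stabilizer z :=
  (mem_stabilizer_iff z β).mpr (mul_mem_span_of_gens z β hβ)

/-- `K_V` is a finite extension of `ℚ` as soon as `V ≠ 0`: `q ↦ q·u` embeds it ℚ-linearly into `V`. -/
theorem stabilizer_finiteDimensional (z : Fin n → ℂ) {u : ℂ} (hu : u ∈ Submodule.span ℚ (Set.range z))
    (hu0 : u ≠ 0) : FiniteDimensional ℚ ↥(stabilizer z) := by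
  haveI : FiniteDimensional ℚ ↥(Submodule.span ℚ (Set.range z)) :=
    FiniteDimensional.span_of_finite ℚ (Set.finite_range z)
  let f : ↥(stabilizer z) →ₗ[ℚ] ↥(Submodule.span ℚ (Set.range z)) :=
    { toFun := fun q => ⟨(q : ℂ) * u, q.2 u hu⟩
      map_add' := fun a b => by ext; simp [add_mul]
      map_smul' := fun r a => by ext; simp }
  have hinj : Function.Injective f := by
    intro a b h
    have h' : (a : ℂ) * u = b * u := congrArg (fun v : ↥(Submodule.span ℚ (Set.range z)) => (v : ℂ)) h
    exact Subtype.ext (mul_right_cancel₀ hu0 h')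
  exact Module.Finite.of_injective f hinj

/-- `[K_V : ℚ] ≤ n` (same embedding). -/
theorem finrank_stabilizer_le (z : Fin n → ℂ) (hz : LinearIndependent ℚ z) {u : ℂ}
    (hu : u ∈ Submodule.span ℚ (Set.range z)) (hu0 : u ≠ 0) : finrank ℚ ↥(stabilizer z) ≤ n := by
  haveI : FiniteDimensional ℚ ↥(Submodule.span ℚ (Set.range z)) :=
    FiniteDimensional.span_of_finite ℚ (Set.finite_range z)
  let f : ↥(stabilizer z) →ₗ[ℚ] ↥(Submodule.span ℚ (Set.range z)) :=
    { toFun := fun q => ⟨(q : ℂ) * u, q.2 u hu⟩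
      map_add' := fun a b => by ext; simp [add_mul]
      map_smul' := fun r a => by ext; simp }
  have hinj : Function.Injective f := by
    intro a b h
    have h' : (a : ℂ) * u = b * u := congrArg (fun v : ↥(Submodule.span ℚ (Set.range z)) => (v : ℂ)) h
    exact Subtype.ext (mul_right_cancel₀ hu0 h')
  calc finrank ℚ ↥(stabilizer z) ≤ finrank ℚ ↥(Submodule.span ℚ (Set.range z)) :=
        LinearMap.finrank_le_finrank_of_injective hinj
    _ = n := by rw [finrank_span_eq_card hz, Fintype.card_fin]

/-- **Primitive multiplier**: `K_V = ℚ(β)` for one multiplier `β ∈ K_V` (primitive element theorem). -/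
theorem exists_primitive_multiplier (z : Fin n → ℂ) {u : ℂ} (hu : u ∈ Submodule.span ℚ (Set.range z))
    (hu0 : u ≠ 0) : ∃ β : ℂ, β ∈ stabilizer z ∧ ℚ⟮β⟯ = stabilizer z := by
  haveI := stabilizer_finiteDimensional z hu hu0
  obtain ⟨α, hα⟩ := Field.exists_primitive_element ℚ ↥(stabilizer z)
  refine ⟨α, α.2, ?_⟩
  calc ℚ⟮(α : ℂ)⟯ = lift (adjoin ℚ {α}) := (lift_adjoin_simple ℚ (stabilizer z) α).symm
    _ = lift (F := stabilizer z) ⊤ := congrArg IntermediateField.lift hα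
    _ = stabilizer z := lift_top ℚ (stabilizer z)

/-- **`[K_V : ℚ] ∣ n`** (`V` is a `K_V`-vector space; via `degree_dvd` at a primitive multiplier). -/
theorem finrank_stabilizer_dvd (z : Fin n → ℂ) (hz : LinearIndependent ℚ z) {u : ℂ}
    (hu : u ∈ Submodule.span ℚ (Set.range z)) (hu0 : u ≠ 0) : finrank ℚ ↥(stabilizer z) ∣ n := by
  haveI := stabilizer_finiteDimensional z hu hu0
  obtain ⟨β, hβ, hK⟩ := exists_primitive_multiplier z hu hu0
  have hβalg : IsAlgebraic ℚ β :=
    isAlgebraic_iff.mp (Algebra.IsAlgebraic.isAlgebraic (⟨β, hβ⟩ : ↥(stabilizer z)))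
  rw [← hK, adjoin.finrank hβalg.isIntegral]
  exact degree_dvd z hz hβalg (fun i => hβ _ (Submodule.subset_span ⟨i, rfl⟩))

/-- **E-stable ⟺ `[K_V : ℚ] ≥ 2`** (for `V ≠ 0`); equivalently PLAIN ⟺ `K_V = ℚ`. -/
theorem eStable_iff_two_le_finrank (z : Fin n → ℂ) {u : ℂ} (hu : u ∈ Submodule.span ℚ (Set.range z))
    (hu0 : u ≠ 0) :
    (∃ β : ℂ, IsAlgebraic ℚ β ∧ β ∉ Set.range (algebraMap ℚ ℂ) ∧
        ∀ i, β * z i ∈ Submodule.span ℚ (Set.range z)) ↔ 2 ≤ finrank ℚ ↥(stabilizer z) := by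
  haveI := stabilizer_finiteDimensional z hu hu0
  have hne : 2 ≤ finrank ℚ ↥(stabilizer z) ↔ stabilizer z ≠ ⊥ := by
    rw [Ne, ← IntermediateField.finrank_eq_one_iff]
    have := Module.finrank_pos (R := ℚ) (M := ↥(stabilizer z))
    omega
  rw [hne]
  constructor
  · rintro ⟨β, -, hβirr, hβV⟩ hbot
    have hβ : β ∈ stabilizer z := mem_stabilizer_of_gens z hβV
    rw [hbot, IntermediateField.mem_bot] at hβ
    exact hβirr hβ
  · intro h
    obtain ⟨q, hq, hqbot⟩ := SetLike.exists_of_lt (bot_lt_iff_ne_bot.mpr h)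
    refine ⟨q, isAlgebraic_iff.mp (Algebra.IsAlgebraic.isAlgebraic (⟨q, hq⟩ : ↥(stabilizer z))), ?_,
      fun i => hq _ (Submodule.subset_span ⟨i, rfl⟩)⟩
    rwa [IntermediateField.mem_bot] at hqbot

/-- PLAIN (every algebraic multiplier is rational) iff the stabilizer field is `ℚ` (for `V ≠ 0`). -/
theorem plain_iff_stabilizer_eq_bot (z : Fin n → ℂ) {u : ℂ} (hu : u ∈ Submodule.span ℚ (Set.range z))
    (hu0 : u ≠ 0) :
    (∀ β : ℂ, IsAlgebraic ℚ β → (∀ i, β * z i ∈ Submodule.span ℚ (Set.range z)) →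
        β ∈ Set.range (algebraMap ℚ ℂ)) ↔ stabilizer z = ⊥ := by
  haveI := stabilizer_finiteDimensional z hu hu0
  constructor
  · intro h
    rw [eq_bot_iff]
    intro q hq
    rw [IntermediateField.mem_bot]
    exact h q (isAlgebraic_iff.mp (Algebra.IsAlgebraic.isAlgebraic (⟨q, hq⟩ : ↥(stabilizer z))))
      (fun i => hq _ (Submodule.subset_span ⟨i, rfl⟩))
  · intro h β _ hβV
    have hβ : β ∈ stabilizer z := mem_stabilizer_of_gens z hβV
    rwa [h, IntermediateField.mem_bot] at hβ

/-- **Canonical cell** (answers «index the cells by the maximal multiplier field»): at a PRIMITIVE multiplier `β`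
(`ℚ(β) = K_V`) the structure theorem gives the cell with `d = [K_V : ℚ]`, `m = n / [K_V : ℚ]`. -/
theorem eStable_canonical_structure (z : Fin n → ℂ) (hz : LinearIndependent ℚ z) {u : ℂ}
    (hu : u ∈ Submodule.span ℚ (Set.range z)) (hu0 : u ≠ 0) :
    ∃ β : ℂ, ℚ⟮β⟯ = stabilizer z ∧ finrank ℚ ↥(stabilizer z) = (minpoly ℚ β).natDegree ∧
      ∃ (m : ℕ) (w : Fin m → ℂ), (minpoly ℚ β).natDegree * m = n ∧
        (∀ j, w j ∈ Submodule.span ℚ (Set.range z)) ∧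
        LinearIndependent ℚ (fun p : Fin (minpoly ℚ β).natDegree × Fin m => β ^ (p.1 : ℕ) * w p.2) ∧
        Submodule.span ℚ (Set.range fun p : Fin (minpoly ℚ β).natDegree × Fin m => β ^ (p.1 : ℕ) * w p.2)
          = Submodule.span ℚ (Set.range z) := by
  haveI := stabilizer_finiteDimensional z hu hu0
  obtain ⟨β, hβ, hK⟩ := exists_primitive_multiplier z hu hu0
  have hβalg : IsAlgebraic ℚ β :=
    isAlgebraic_iff.mp (Algebra.IsAlgebraic.isAlgebraic (⟨β, hβ⟩ : ↥(stabilizer z)))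
  refine ⟨β, hK, by rw [← hK, adjoin.finrank hβalg.isIntegral], ?_⟩
  exact eStable_structure z hz hβalg (fun i => hβ _ (Submodule.subset_span ⟨i, rfl⟩))

/-- lens-1's `symmetric` predicate is `K_V ≠ ℚ` — with NO hypothesis on `z`. -/
theorem symmetric_iff_stabilizer_ne_bot (z : Fin n → ℂ) :
    (∃ q : ℂ, (∀ v ∈ Submodule.span ℚ (Set.range z), q * v ∈ Submodule.span ℚ (Set.range z)) ∧
        ∀ r : ℚ, (r : ℂ) ≠ q) ↔ stabilizer z ≠ ⊥ := by
  constructor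
  · rintro ⟨q, hq, hirr⟩ hbot
    have hq' : q ∈ stabilizer z := hq
    rw [hbot, IntermediateField.mem_bot] at hq'
    obtain ⟨r, hr⟩ := hq'
    exact hirr r hr
  · intro h
    obtain ⟨q, hq, hqbot⟩ := SetLike.exists_of_lt (bot_lt_iff_ne_bot.mpr h)
    refine ⟨q, hq, fun r hr => hqbot ?_⟩
    rw [IntermediateField.mem_bot]; exact ⟨r, hr⟩

/-- lens-1's `asymmetric` predicate is `K_V = ℚ` — with NO hypothesis on `z`. -/
theorem asymmetric_iff_stabilizer_eq_bot (z : Fin n → ℂ) :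
    (∀ q : ℂ, (∀ v ∈ Submodule.span ℚ (Set.range z), q * v ∈ Submodule.span ℚ (Set.range z)) →
        ∃ r : ℚ, (r : ℂ) = q) ↔ stabilizer z = ⊥ := by
  constructor
  · intro h
    rw [eq_bot_iff]
    intro q hq
    rw [IntermediateField.mem_bot]
    obtain ⟨r, hr⟩ := h q hq
    exact ⟨r, hr⟩
  · intro h q hq
    have hq' : q ∈ stabilizer z := hq
    rw [h, IntermediateField.mem_bot] at hq'
    obtain ⟨r, hr⟩ := hq'
    exact ⟨r, hr⟩

end Summit.Schanuel.Schanuel.Theorems.RootDecomp1EStabilizerField
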